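import Summits.CriticalPhenomena.PercolationContinuityZ3.Theorems.Transplant.SkelNegBParamsFaceCountsYA
import Summits.CriticalPhenomena.PercolationContinuityZ3.Theorems.Transplant.SkelNegBParamsFaceFloorsClrXA
import Summits.CriticalPhenomena.PercolationContinuityZ3.Theorems.Transplant.SkelNegBParamsFaceTop
import Summits.CriticalPhenomena.PercolationContinuityZ3.Theorems.Transplant.SkelPhiFaceNumsYFace
import HarnessLib

/-!
# N1 params, M3′ (y′-face floors at the (ζ′) tuple), group G-L′ — **THE TARGET BOX ON THE x-RUN'S LAST CORE**: the fields `FL1–FL4` of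
# `Skelφ.FloorsY2` (SkelPhiFaceNumsYP2) at the (F) wrapper's consumer shape (HOME prim-hp-8/F-GLUE-CONSUMER-SHAPE.md §3, binder `floorsY`),
# HYPOTHESIS-PARAMETRIC (generic tangential origin `yT`, sign `τ = ±1`, core index `k`, start half-width `q`): the y′-face's tangential x-run
# (origin `yT := yL + crossOffY …`, `u`-strides, sign `σT`) must place its core `k := N₃ + 1` — α-range `[xCSLo, xCSHi] = τkn ∓ (q + kR′)`
# (`xCS_eval`), level half-height `xCoreB + 1 = W + kR′ + 1` with `U·(W + kR′ + 1) ≤ m + 11n_L(kR′ + 3)` (`xCoreB_env`) — inside the arrival box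
# `cen (x + e_du) ± (b0TA − 2)` (`b0TA 0 = 10·Kq·u₀`, `b0TA 1 = 10·Kq·u₁`), given the two POSITION FACTS the integrator serves from the counts
# (`KS.N3Y_spec`, `KS.NrY_spec`, part 0′ p3xx) and the cross-shift drift (part 1b′): `|FcA yT + τ·u₀·k − T0Y| ≤ 3u₀` (along reading of core `k`
# vs the transverse target) and `|F1cA yT − T1Y| ≤ 3u₁` (the x-run keeps `Λ₁`).  Budgets: `q + k·RA′ ≤ 3n_L` (`qB3YA (RA′) = 2n_L + 1000Kq·RA′`,
# `n_L ≥ 2400Kq(RA′+2)`), `11·(k·RA′ + 4) ≤ ℓ_L`, `6RA′ + 11 ≤ u₀A` (cells_geTA').  Twin in rôle of p3-g12's x-face G-L (FloorsLXA/L2XA).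
builds on p205010 (kernel theorem, internal audit signed; external expert review pending) — nothing in this file uses p205010; NOTHING is claimed about the node
`SamePDropOfSkeletonNeg₁` (OPEN); integer arithmetic only.
Lane `prim-bschramm`, seat `prim-hp-8` (gen 36; y′-face twins per lead 06:53:24Z); helper file (`--supports stmt-CriticalPhenomena-4575 --as helper`); slot-ledger ζ′ v1/v2.
* `xCS_eval`, `xCoreB_env`, `lastCore_room₀/₁` (the two budget inequalities), **`FL1_YA_gen … FL4_YA_gen`**.
[cite: KozmaNitzan2024, §4 Lemma 12 (pp. 23–25)] [cite: MartineauTassion2017, §4.1]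
-/

noncomputable section

open scoped Classical

namespace Summit.CriticalPhenomena.PercolationContinuityZ3.Theorems.Transplant

namespace PlanarSkeletonNeg

namespace NegB

open Literature.Probability.Percolation Literature.Probability.LatticeModels SimpleGraph
open Literature.Probability.Percolation.KozmaNitzan.Cells (oth sgOf sgOf_sign stepVec_apply_fst stepVec_apply_oth)
open SkelConc (Consts)
open Skelφ (shearUnit xCSLo xCSHi xCoreB)
open Skelφ.StepI (DataN)
open TwoAxis.Para (modulus)
open Neg

namespace KS

/-- **The signed core ends are linear**: `xCSLo n q R′ τ k = τ·k·n − (q + k·R′)`, `xCSHi … = τ·k·n + (q + k·R′)` for `τ = ±1`. [folklore] -/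
theorem xCS_eval (n q R' : ℕ) {τ : ℤ} (hτ : τ = 1 ∨ τ = -1) (k : ℕ) :
    xCSLo n q R' τ k = τ * ((k : ℤ) * n) - ((q : ℤ) + (k : ℤ) * R') ∧ xCSHi n q R' τ k = τ * ((k : ℤ) * n) + ((q : ℤ) + (k : ℤ) * R') := by
  have hq : (0 : ℤ) ≤ (q : ℤ) + (k : ℤ) * R' := by positivity
  unfold Skelφ.xCSLo Skelφ.xCSHi
  rcases hτ with h | h <;> subst h
  · refine ⟨?_, ?_⟩
    · rw [min_eq_left (by linarith)]; ring
    · rw [max_eq_right (by linarith)]; ring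
  · refine ⟨?_, ?_⟩
    · rw [min_eq_right (by linarith)]; ring
    · rw [max_eq_left (by linarith)]; ring

section LastCoreY

variable (κ : Consts) {V : Type} [DecidableEq V] [Countable V] {G : SimpleGraph V} [G.LocallyFinite] (Φ : PlanarSkeletonNeg G) (t : V)
  (p : unitInterval) (D : DataN V) (mk g f : ℕ)

/-- **The last core's level extent against the modulus**: `0 ≤ xCoreB` and `U·(xCoreB n_L ℓ_L h_L R′ k + 1) ≤ m + 11·n_L·(k·R′ + 3)`
(`U·W ≤ n_Lℓ_L + U ≤ m + 2U − 1`, `U ≤ 11 n_L`). [folklore] -/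
theorem xCoreB_env (hN : EqNumL κ Φ t p D g f) (hκ : (hL κ Φ t p D g f).natAbs ≤ 10 * nL κ Φ t p D g f) (R' k : ℕ) :
    0 ≤ xCoreB (nL κ Φ t p D g f) (ℓL κ Φ t p D g f) (hL κ Φ t p D g f) R' k ∧
      (shearUnit (nL κ Φ t p D g f) (hL κ Φ t p D g f) : ℤ) * (xCoreB (nL κ Φ t p D g f) (ℓL κ Φ t p D g f) (hL κ Φ t p D g f) R' k + 1) ≤ (modulus (nL κ Φ t p D g f) (hL κ Φ t p D g f) (vL κ Φ t p D g f) (vβL κ Φ t p D g f)) + 11 * ((nL κ Φ t p D g f) : ℤ) * ((k : ℤ) * R' + 3) := by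
  obtain ⟨hn1, hℓ1⟩ := one_le_of_eqNumL κ Φ t p D g f hN
  obtain ⟨hU1, hU2⟩ := clr_shearUnit_bounds κ Φ t p D g f hκ
  obtain ⟨hmlo, -⟩ := modulus_top κ Φ t p D g f hn1
  refine ⟨by unfold Skelφ.xCoreB; positivity, ?_⟩
  have hUW : (shearUnit (nL κ Φ t p D g f) (hL κ Φ t p D g f) : ℤ) * (((nL κ Φ t p D g f) * (ℓL κ Φ t p D g f) / shearUnit (nL κ Φ t p D g f) (hL κ Φ t p D g f) + 1 : ℕ) : ℤ) ≤ ((nL κ Φ t p D g f) : ℤ) * (ℓL κ Φ t p D g f) + shearUnit (nL κ Φ t p D g f) (hL κ Φ t p D g f) := by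
    have h := Nat.div_mul_le_self ((nL κ Φ t p D g f) * (ℓL κ Φ t p D g f)) (shearUnit (nL κ Φ t p D g f) (hL κ Φ t p D g f))
    have h' : shearUnit (nL κ Φ t p D g f) (hL κ Φ t p D g f) * ((nL κ Φ t p D g f) * (ℓL κ Φ t p D g f) / shearUnit (nL κ Φ t p D g f) (hL κ Φ t p D g f) + 1) ≤ (nL κ Φ t p D g f) * (ℓL κ Φ t p D g f) + shearUnit (nL κ Φ t p D g f) (hL κ Φ t p D g f) := by
      rw [Nat.mul_add, Nat.mul_one, Nat.mul_comm]; exact Nat.add_le_add_right h _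
    exact_mod_cast h'
  unfold Skelφ.xCoreB
  have hk0 : (0 : ℤ) ≤ (k : ℤ) * R' := by positivity
  have hn0 : (0 : ℤ) ≤ ((nL κ Φ t p D g f) : ℤ) := by positivity
  have e : (shearUnit (nL κ Φ t p D g f) (hL κ Φ t p D g f) : ℤ) * (((((nL κ Φ t p D g f) * (ℓL κ Φ t p D g f) / shearUnit (nL κ Φ t p D g f) (hL κ Φ t p D g f) + 1 : ℕ) : ℤ) + (k : ℤ) * R') + 1) =
      (shearUnit (nL κ Φ t p D g f) (hL κ Φ t p D g f) : ℤ) * (((nL κ Φ t p D g f) * (ℓL κ Φ t p D g f) / shearUnit (nL κ Φ t p D g f) (hL κ Φ t p D g f) + 1 : ℕ) : ℤ) + (shearUnit (nL κ Φ t p D g f) (hL κ Φ t p D g f) : ℤ) * ((k : ℤ) * R' + 1) := by ring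
  rw [e]
  have h2 : (shearUnit (nL κ Φ t p D g f) (hL κ Φ t p D g f) : ℤ) * ((k : ℤ) * R' + 1) ≤ 11 * ((nL κ Φ t p D g f) : ℤ) * ((k : ℤ) * R' + 1) := mul_le_mul_of_nonneg_right hU2 (by positivity)
  nlinarith

/-- **The α-budget of the last core**: `u₀·m·(q + kR′) + u₀·n·U·(xCoreB + 1) + u₀·n ≤ n·m·(10Kq·u₀ − 3u₀ − 3)` under `q + kR′ ≤ 3n_L`,
`11(kR′ + 4) ≤ ℓ_L`, `6RA′ + 11 ≤ u₀`. [folklore] -/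
theorem lastCore_room₀ (hN : EqNumL κ Φ t p D g f) (hκ : (hL κ Φ t p D g f).natAbs ≤ 10 * nL κ Φ t p D g f) {q k : ℕ}
    (hq3 : (q : ℤ) + (k : ℤ) * (RA' κ Φ t p D mk : ℤ) ≤ 3 * ((nL κ Φ t p D g f) : ℤ)) (hℓk : 11 * ((k : ℤ) * (RA' κ Φ t p D mk : ℤ) + 4) ≤ ((ℓL κ Φ t p D g f) : ℤ))
    (hs0 : 6 * (RA' κ Φ t p D mk : ℤ) + 11 ≤ u₀A κ Φ t p D g f) :
    u₀A κ Φ t p D g f * (modulus (nL κ Φ t p D g f) (hL κ Φ t p D g f) (vL κ Φ t p D g f) (vβL κ Φ t p D g f)) * ((q : ℤ) + (k : ℤ) * (RA' κ Φ t p D mk : ℤ)) + u₀A κ Φ t p D g f * ((nL κ Φ t p D g f) : ℤ) * ((shearUnit (nL κ Φ t p D g f) (hL κ Φ t p D g f) : ℤ) * (xCoreB (nL κ Φ t p D g f) (ℓL κ Φ t p D g f) (hL κ Φ t p D g f) (RA' κ Φ t p D mk) k + 1)) +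
        u₀A κ Φ t p D g f * ((nL κ Φ t p D g f) : ℤ) ≤ ((nL κ Φ t p D g f) : ℤ) * (modulus (nL κ Φ t p D g f) (hL κ Φ t p D g f) (vL κ Φ t p D g f) (vβL κ Φ t p D g f)) * (10 * (Neg.Kq κ : ℤ) * u₀A κ Φ t p D g f - 3 * u₀A κ Φ t p D g f - 3) := by
  obtain ⟨hn1, hℓ1⟩ := one_le_of_eqNumL κ Φ t p D g f hN
  obtain ⟨hU1, hU2⟩ := clr_shearUnit_bounds κ Φ t p D g f hκ
  obtain ⟨hmlo, -⟩ := modulus_top κ Φ t p D g f hn1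
  obtain ⟨-, henv⟩ := xCoreB_env κ Φ t p D g f hN hκ (RA' κ Φ t p D mk) k
  have hm0 : 0 < (modulus (nL κ Φ t p D g f) (hL κ Φ t p D g f) (vL κ Φ t p D g f) (vβL κ Φ t p D g f)) := Skelφ.NegPrm.modulus_vβOf_pos hn1 hℓ1 _ _
  have hq1 : (1 : ℤ) ≤ Neg.Kq κ := by exact_mod_cast Neg.one_le_Kq κ
  have hR0 : (0 : ℤ) ≤ (RA' κ Φ t p D mk : ℤ) := Nat.cast_nonneg _
  have hn : (1 : ℤ) ≤ ((nL κ Φ t p D g f) : ℤ) := by exact_mod_cast hn1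
  set n : ℤ := ((nL κ Φ t p D g f) : ℤ)
  set m : ℤ := (modulus (nL κ Φ t p D g f) (hL κ Φ t p D g f) (vL κ Φ t p D g f) (vβL κ Φ t p D g f))
  set u : ℤ := u₀A κ Φ t p D g f
  set Uz : ℤ := (shearUnit (nL κ Φ t p D g f) (hL κ Φ t p D g f) : ℤ)
  set X : ℤ := xCoreB (nL κ Φ t p D g f) (ℓL κ Φ t p D g f) (hL κ Φ t p D g f) (RA' κ Φ t p D mk) k
  set kR : ℤ := (k : ℤ) * (RA' κ Φ t p D mk : ℤ)
  have hu0 : 0 ≤ u := by linarith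
  have hkR0 : 0 ≤ kR := by positivity
  -- `m ≥ n(ℓ − 11) + 1`
  have hml : n * (((ℓL κ Φ t p D g f) : ℤ) - 11) + 1 ≤ m := by nlinarith
  -- the three pieces
  have h1 : u * m * ((q : ℤ) + kR) ≤ 3 * (u * n * m) := by
    have := mul_le_mul_of_nonneg_left hq3 (mul_nonneg hu0 hm0.le); linarith
  have h2 : u * n * (Uz * (X + 1)) ≤ u * n * m + 11 * (u * n * n) * (kR + 3) := by
    have := mul_le_mul_of_nonneg_left henv (mul_nonneg hu0 (by linarith : (0:ℤ) ≤ n)); linarith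
  -- `11 n (kR + 3) + 1 ≤ 2 (n (ℓ − 11) + 1) ≤ 2m` and `2u ≤ 3u − 3`
  have h3 : 11 * n * (kR + 3) + 1 ≤ 2 * m := by nlinarith
  have h4 : 11 * (u * n * n) * (kR + 3) + u * n ≤ n * m * (3 * u - 3) := by
    have a : u * (11 * n * (kR + 3) + 1) ≤ u * (2 * m) := mul_le_mul_of_nonneg_left h3 hu0
    have b : u * (2 * m) ≤ m * (3 * u - 3) := by nlinarith
    have c : n * (u * (11 * n * (kR + 3) + 1)) ≤ n * (m * (3 * u - 3)) := mul_le_mul_of_nonneg_left (a.trans b) (by linarith)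
    linarith
  have h5 : n * m * (7 * u - 3) ≤ n * m * (10 * (Neg.Kq κ : ℤ) * u - 3 * u - 3) := by
    have : 7 * u - 3 ≤ 10 * (Neg.Kq κ : ℤ) * u - 3 * u - 3 := by nlinarith
    exact mul_le_mul_of_nonneg_left this (mul_nonneg (by linarith) hm0.le)
  nlinarith

/-- **The level budget of the last core**: `11·u₁·n·(kR′ + 3) ≤ m·(6u₁ − 3)` under `11(kR′+4) ≤ ℓ_L`. [folklore] -/
theorem lastCore_room₁ (hN : EqNumL κ Φ t p D g f) (hκ : (hL κ Φ t p D g f).natAbs ≤ 10 * nL κ Φ t p D g f) {k : ℕ}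
    (hℓk : 11 * ((k : ℤ) * (RA' κ Φ t p D mk : ℤ) + 4) ≤ ((ℓL κ Φ t p D g f) : ℤ)) :
    11 * u₁A κ Φ t p D g f * ((nL κ Φ t p D g f) : ℤ) * ((k : ℤ) * (RA' κ Φ t p D mk : ℤ) + 3) + 1 ≤ (modulus (nL κ Φ t p D g f) (hL κ Φ t p D g f) (vL κ Φ t p D g f) (vβL κ Φ t p D g f)) * (6 * u₁A κ Φ t p D g f - 3) := by
  obtain ⟨hn1, hℓ1⟩ := one_le_of_eqNumL κ Φ t p D g f hN
  obtain ⟨hU1, hU2⟩ := clr_shearUnit_bounds κ Φ t p D g f hκ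
  obtain ⟨hmlo, -⟩ := modulus_top κ Φ t p D g f hn1
  have hm0 : 0 < (modulus (nL κ Φ t p D g f) (hL κ Φ t p D g f) (vL κ Φ t p D g f) (vβL κ Φ t p D g f)) := Skelφ.NegPrm.modulus_vβOf_pos hn1 hℓ1 _ _
  have hw : 1 ≤ u₁A κ Φ t p D g f := (units_eqA κ Φ t p D g f).2.2.2.2.2.2.2
  have hR0 : (0 : ℤ) ≤ (RA' κ Φ t p D mk : ℤ) := Nat.cast_nonneg _
  have hn : (1 : ℤ) ≤ ((nL κ Φ t p D g f) : ℤ) := by exact_mod_cast hn1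
  set n : ℤ := ((nL κ Φ t p D g f) : ℤ)
  set m : ℤ := (modulus (nL κ Φ t p D g f) (hL κ Φ t p D g f) (vL κ Φ t p D g f) (vβL κ Φ t p D g f))
  set w : ℤ := u₁A κ Φ t p D g f
  set kR : ℤ := (k : ℤ) * (RA' κ Φ t p D mk : ℤ)
  have hkR0 : 0 ≤ kR := by positivity
  have hml : n * (((ℓL κ Φ t p D g f) : ℤ) - 11) + 1 ≤ m := by nlinarith
  have h3 : 11 * n * (kR + 3) + 1 ≤ 2 * m := by nlinarith
  have a : w * (11 * n * (kR + 3) + 1) ≤ w * (2 * m) := mul_le_mul_of_nonneg_left h3 (by linarith)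
  have b : w * (2 * m) ≤ m * (6 * w - 3) := by nlinarith
  nlinarith

/-- **`FL3` (y′-face) generic**: the last core's lower transverse (axis-1) reading is inside the arrival box, given `|F1cA yT − T1Y| ≤ 3u₁`.
[cite: KozmaNitzan2024, §4 Lemma 12 (pp. 23–25)] -/
theorem FL3_YA_gen (hN : EqNumL κ Φ t p D g f) (hκ : (hL κ Φ t p D g f).natAbs ≤ 10 * nL κ Φ t p D g f) (x : Site 2) (du : MDir) (z : Site 2)
    (yT : Site 2) {k : ℕ} (hT1 : |F1cA κ Φ t p D g f yT - T1Y κ Φ t p D g f x du z| ≤ 3 * u₁A κ Φ t p D g f)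
    (hℓk : 11 * ((k : ℤ) * (RA' κ Φ t p D mk : ℤ) + 4) ≤ ((ℓL κ Φ t p D g f) : ℤ)) :
    (modulus (nL κ Φ t p D g f) (hL κ Φ t p D g f) (vL κ Φ t p D g f) (vβL κ Φ t p D g f)) * ((fcellsA κ Φ t p D g f).cen (x + stepVec du) 1 - (b0TA κ Φ t p D g f 1 : ℤ) + 2 - z 1 - F1cA κ Φ t p D g f yT) ≤
      -(u₁A κ Φ t p D g f * (shearUnit (nL κ Φ t p D g f) (hL κ Φ t p D g f) : ℤ) * (xCoreB (nL κ Φ t p D g f) (ℓL κ Φ t p D g f) (hL κ Φ t p D g f) (RA' κ Φ t p D mk) k + 1)) - (modulus (nL κ Φ t p D g f) (hL κ Φ t p D g f) (vL κ Φ t p D g f) (vβL κ Φ t p D g f)) + 1 := by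
  obtain ⟨hn1, hℓ1⟩ := one_le_of_eqNumL κ Φ t p D g f hN
  have hm0 : 0 < (modulus (nL κ Φ t p D g f) (hL κ Φ t p D g f) (vL κ Φ t p D g f) (vβL κ Φ t p D g f)) := Skelφ.NegPrm.modulus_vβOf_pos hn1 hℓ1 _ _
  obtain ⟨hX0, henv⟩ := xCoreB_env κ Φ t p D g f hN hκ (RA' κ Φ t p D mk) k
  have hroom := lastCore_room₁ κ Φ t p D mk g f hN hκ hℓk
  have hw : 1 ≤ u₁A κ Φ t p D g f := (units_eqA κ Φ t p D g f).2.2.2.2.2.2.2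
  have hb : (b0TA κ Φ t p D g f 1 : ℤ) = 10 * (Neg.Kq κ : ℤ) * u₁A κ Φ t p D g f := (units_eqA κ Φ t p D g f).2.2.2.2.2.1
  have hq1 : (1 : ℤ) ≤ Neg.Kq κ := by exact_mod_cast Neg.one_le_Kq κ
  have hT : (fcellsA κ Φ t p D g f).cen (x + stepVec du) 1 - z 1 = T1Y κ Φ t p D g f x du z := rfl
  obtain ⟨a1, a2⟩ := abs_le.1 hT1
  rw [hb]
  set m : ℤ := (modulus (nL κ Φ t p D g f) (hL κ Φ t p D g f) (vL κ Φ t p D g f) (vβL κ Φ t p D g f))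
  set w : ℤ := u₁A κ Φ t p D g f
  set n : ℤ := ((nL κ Φ t p D g f) : ℤ)
  set Uz : ℤ := (shearUnit (nL κ Φ t p D g f) (hL κ Φ t p D g f) : ℤ)
  set X : ℤ := xCoreB (nL κ Φ t p D g f) (ℓL κ Φ t p D g f) (hL κ Φ t p D g f) (RA' κ Φ t p D mk) k
  set F1 := F1cA κ Φ t p D g f yT
  set T1 := T1Y κ Φ t p D g f x du z
  have hKw : 10 * w ≤ 10 * (Neg.Kq κ : ℤ) * w := by nlinarith
  have hL : m * ((fcellsA κ Φ t p D g f).cen (x + stepVec du) 1 - 10 * (Neg.Kq κ : ℤ) * w + 2 - z 1 - F1) ≤ m * (2 - 7 * w) := by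
    apply mul_le_mul_of_nonneg_left _ hm0.le
    have : (fcellsA κ Φ t p D g f).cen (x + stepVec du) 1 - z 1 - F1 ≤ 3 * w := by rw [hT]; linarith
    linarith
  have hR : w * (Uz * (X + 1)) ≤ w * m + 11 * w * n * ((k : ℤ) * (RA' κ Φ t p D mk : ℤ) + 3) := by
    have := mul_le_mul_of_nonneg_left henv (by linarith : (0 : ℤ) ≤ w); linarith
  have e : w * Uz * (X + 1) = w * (Uz * (X + 1)) := by ring
  rw [e]
  linarith

/-- **`FL4` (y′-face) generic**: the last core's upper transverse (axis-1) reading is inside the arrival box. [cite: KozmaNitzan2024, §4 Lemma 12 (pp. 23–25)] -/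
theorem FL4_YA_gen (hN : EqNumL κ Φ t p D g f) (hκ : (hL κ Φ t p D g f).natAbs ≤ 10 * nL κ Φ t p D g f) (x : Site 2) (du : MDir) (z : Site 2)
    (yT : Site 2) {k : ℕ} (hT1 : |F1cA κ Φ t p D g f yT - T1Y κ Φ t p D g f x du z| ≤ 3 * u₁A κ Φ t p D g f)
    (hℓk : 11 * ((k : ℤ) * (RA' κ Φ t p D mk : ℤ) + 4) ≤ ((ℓL κ Φ t p D g f) : ℤ)) :
    (modulus (nL κ Φ t p D g f) (hL κ Φ t p D g f) (vL κ Φ t p D g f) (vβL κ Φ t p D g f)) * (F1cA κ Φ t p D g f yT + 1) + u₁A κ Φ t p D g f * ((shearUnit (nL κ Φ t p D g f) (hL κ Φ t p D g f) : ℤ) * xCoreB (nL κ Φ t p D g f) (ℓL κ Φ t p D g f) (hL κ Φ t p D g f) (RA' κ Φ t p D mk) k + (shearUnit (nL κ Φ t p D g f) (hL κ Φ t p D g f) : ℤ) - 1) ≤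
      (modulus (nL κ Φ t p D g f) (hL κ Φ t p D g f) (vL κ Φ t p D g f) (vβL κ Φ t p D g f)) * ((fcellsA κ Φ t p D g f).cen (x + stepVec du) 1 + (b0TA κ Φ t p D g f 1 : ℤ) - 2 - z 1) := by
  obtain ⟨hn1, hℓ1⟩ := one_le_of_eqNumL κ Φ t p D g f hN
  have hm0 : 0 < (modulus (nL κ Φ t p D g f) (hL κ Φ t p D g f) (vL κ Φ t p D g f) (vβL κ Φ t p D g f)) := Skelφ.NegPrm.modulus_vβOf_pos hn1 hℓ1 _ _
  obtain ⟨hX0, henv⟩ := xCoreB_env κ Φ t p D g f hN hκ (RA' κ Φ t p D mk) k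
  have hroom := lastCore_room₁ κ Φ t p D mk g f hN hκ hℓk
  have hw : 1 ≤ u₁A κ Φ t p D g f := (units_eqA κ Φ t p D g f).2.2.2.2.2.2.2
  have hb : (b0TA κ Φ t p D g f 1 : ℤ) = 10 * (Neg.Kq κ : ℤ) * u₁A κ Φ t p D g f := (units_eqA κ Φ t p D g f).2.2.2.2.2.1
  have hq1 : (1 : ℤ) ≤ Neg.Kq κ := by exact_mod_cast Neg.one_le_Kq κ
  have hT : (fcellsA κ Φ t p D g f).cen (x + stepVec du) 1 - z 1 = T1Y κ Φ t p D g f x du z := rfl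
  obtain ⟨a1, a2⟩ := abs_le.1 hT1
  rw [hb]
  set m : ℤ := (modulus (nL κ Φ t p D g f) (hL κ Φ t p D g f) (vL κ Φ t p D g f) (vβL κ Φ t p D g f))
  set w : ℤ := u₁A κ Φ t p D g f
  set n : ℤ := ((nL κ Φ t p D g f) : ℤ)
  set Uz : ℤ := (shearUnit (nL κ Φ t p D g f) (hL κ Φ t p D g f) : ℤ)
  set X : ℤ := xCoreB (nL κ Φ t p D g f) (ℓL κ Φ t p D g f) (hL κ Φ t p D g f) (RA' κ Φ t p D mk) k
  set F1 := F1cA κ Φ t p D g f yT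
  set T1 := T1Y κ Φ t p D g f x du z
  have hKw : 10 * w ≤ 10 * (Neg.Kq κ : ℤ) * w := by nlinarith
  have ec : (fcellsA κ Φ t p D g f).cen (x + stepVec du) 1 + 10 * (Neg.Kq κ : ℤ) * w - 2 - z 1 = T1 + 10 * (Neg.Kq κ : ℤ) * w - 2 := by rw [← hT]; ring
  rw [ec]
  have hL : m * (T1 + 4 * w + 1) + m * (6 * w - 3) ≤ m * (T1 + 10 * (Neg.Kq κ : ℤ) * w - 2) := by
    have h : T1 + 4 * w + 1 + (6 * w - 3) ≤ T1 + 10 * (Neg.Kq κ : ℤ) * w - 2 := by linarith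
    have := mul_le_mul_of_nonneg_left h hm0.le
    linarith [mul_add m (T1 + 4 * w + 1) (6 * w - 3)]
  have hF : m * (F1 + 1) ≤ m * (T1 + 3 * w + 1) := mul_le_mul_of_nonneg_left (by linarith) hm0.le
  have e : m * (T1 + 3 * w + 1) + w * m = m * (T1 + 4 * w + 1) := by ring
  have hR : w * (Uz * X + Uz - 1) ≤ w * m + 11 * w * n * ((k : ℤ) * (RA' κ Φ t p D mk : ℤ) + 3) - w := by
    have e2 : w * (Uz * X + Uz - 1) = w * (Uz * (X + 1)) - w := by ring
    rw [e2]
    have := mul_le_mul_of_nonneg_left henv (by linarith : (0 : ℤ) ≤ w)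
    linarith
  linarith

/-- **`FL1` (y′-face) generic**: the last core's lower along (axis-0) reading is inside the arrival box, given `|FcA yT + τ·u₀·k − T0Y| ≤ 3u₀`
(`τ = ±1` the x-run's sign, `k` the core index, `q` its start half-width). [cite: KozmaNitzan2024, §4 Lemma 12 (pp. 23–25)] -/
theorem FL1_YA_gen (hN : EqNumL κ Φ t p D g f) (hκ : (hL κ Φ t p D g f).natAbs ≤ 10 * nL κ Φ t p D g f) (x : Site 2) (du : MDir) (hd : du.1 = 1) (z : Site 2)
    (yT : Site 2) {τ : ℤ} (hτ : τ = 1 ∨ τ = -1) {q k : ℕ}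
    (hT0 : |FcA κ Φ t p D g f yT + τ * u₀A κ Φ t p D g f * (k : ℤ) - T0Y κ Φ t p D g f x z| ≤ 3 * u₀A κ Φ t p D g f)
    (hq3 : (q : ℤ) + (k : ℤ) * (RA' κ Φ t p D mk : ℤ) ≤ 3 * ((nL κ Φ t p D g f) : ℤ)) (hℓk : 11 * ((k : ℤ) * (RA' κ Φ t p D mk : ℤ) + 4) ≤ ((ℓL κ Φ t p D g f) : ℤ)) (hs0 : 6 * (RA' κ Φ t p D mk : ℤ) + 11 ≤ u₀A κ Φ t p D g f) :
    ((nL κ Φ t p D g f) : ℤ) * (modulus (nL κ Φ t p D g f) (hL κ Φ t p D g f) (vL κ Φ t p D g f) (vβL κ Φ t p D g f)) * ((fcellsA κ Φ t p D g f).cen (x + stepVec du) 0 - (b0TA κ Φ t p D g f 0 : ℤ) + 2 - z 0 - FcA κ Φ t p D g f yT) ≤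
      ((((fcellsA κ Φ t p D g f).s 0 : ℕ) : ℤ)) * (modulus (nL κ Φ t p D g f) (hL κ Φ t p D g f) (vL κ Φ t p D g f) (vβL κ Φ t p D g f)) * xCSLo (nL κ Φ t p D g f) q (RA' κ Φ t p D mk) τ k -
        ((((fcellsA κ Φ t p D g f).s 0 : ℕ) : ℤ)) * (((nL κ Φ t p D g f) : ℕ) : ℤ) * (shearUnit (nL κ Φ t p D g f) (hL κ Φ t p D g f) : ℤ) * (xCoreB (nL κ Φ t p D g f) (ℓL κ Φ t p D g f) (hL κ Φ t p D g f) (RA' κ Φ t p D mk) k + 1) -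
        ((((fcellsA κ Φ t p D g f).s 0 : ℕ) : ℤ)) * ((nL κ Φ t p D g f) : ℤ) - ((nL κ Φ t p D g f) : ℤ) * (modulus (nL κ Φ t p D g f) (hL κ Φ t p D g f) (vL κ Φ t p D g f) (vβL κ Φ t p D g f)) := by
  obtain ⟨hn1, hℓ1⟩ := one_le_of_eqNumL κ Φ t p D g f hN
  have hm0 : 0 < (modulus (nL κ Φ t p D g f) (hL κ Φ t p D g f) (vL κ Φ t p D g f) (vβL κ Φ t p D g f)) := Skelφ.NegPrm.modulus_vβOf_pos hn1 hℓ1 _ _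
  obtain ⟨hlo, -⟩ := xCS_eval (nL κ Φ t p D g f) q (RA' κ Φ t p D mk) hτ k
  have hroom := lastCore_room₀ κ Φ t p D mk g f hN hκ hq3 hℓk hs0
  have es : ((((fcellsA κ Φ t p D g f).s 0 : ℕ) : ℤ)) = u₀A κ Φ t p D g f := rfl
  have hb : (b0TA κ Φ t p D g f 0 : ℤ) = 10 * (Neg.Kq κ : ℤ) * u₀A κ Φ t p D g f := (units_eqA κ Φ t p D g f).2.2.2.2.1
  have hT : (fcellsA κ Φ t p D g f).cen (x + stepVec du) 0 - z 0 = T0Y κ Φ t p D g f x z := by rw [cen_step_zero κ Φ t p D g f x du hd]; rfl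
  obtain ⟨a1, a2⟩ := abs_le.1 hT0
  have hn : (1 : ℤ) ≤ ((nL κ Φ t p D g f) : ℤ) := by exact_mod_cast hn1
  rw [es, hb, hlo]
  set m : ℤ := (modulus (nL κ Φ t p D g f) (hL κ Φ t p D g f) (vL κ Φ t p D g f) (vβL κ Φ t p D g f))
  set u : ℤ := u₀A κ Φ t p D g f
  set n : ℤ := ((nL κ Φ t p D g f) : ℤ)
  set Uz : ℤ := (shearUnit (nL κ Φ t p D g f) (hL κ Φ t p D g f) : ℤ)
  set X : ℤ := xCoreB (nL κ Φ t p D g f) (ℓL κ Φ t p D g f) (hL κ Φ t p D g f) (RA' κ Φ t p D mk) k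
  set F0 := FcA κ Φ t p D g f yT
  set T0 := T0Y κ Φ t p D g f x z
  set kR : ℤ := (k : ℤ) * (RA' κ Φ t p D mk : ℤ)
  have hL : n * m * ((fcellsA κ Φ t p D g f).cen (x + stepVec du) 0 - 10 * (Neg.Kq κ : ℤ) * u + 2 - z 0 - F0) ≤
      n * m * (τ * u * (k : ℤ) + 3 * u + 2 - 10 * (Neg.Kq κ : ℤ) * u) := by
    apply mul_le_mul_of_nonneg_left _ (mul_nonneg (by linarith) hm0.le)
    rw [show (fcellsA κ Φ t p D g f).cen (x + stepVec du) 0 - 10 * (Neg.Kq κ : ℤ) * u + 2 - z 0 - F0 =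
      ((fcellsA κ Φ t p D g f).cen (x + stepVec du) 0 - z 0) - 10 * (Neg.Kq κ : ℤ) * u + 2 - F0 by ring, hT]
    linarith
  have e1 : u * m * (τ * ((k : ℤ) * n) - ((q : ℤ) + kR)) = n * m * (τ * u * (k : ℤ)) - u * m * ((q : ℤ) + kR) := by ring
  rw [e1]
  have e2 : u * n * Uz * (X + 1) = u * n * (Uz * (X + 1)) := by ring
  rw [e2]
  nlinarith

/-- **`FL2` (y′-face) generic**: the last core's upper along (axis-0) reading is inside the arrival box. [cite: KozmaNitzan2024, §4 Lemma 12 (pp. 23–25)] -/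
theorem FL2_YA_gen (hN : EqNumL κ Φ t p D g f) (hκ : (hL κ Φ t p D g f).natAbs ≤ 10 * nL κ Φ t p D g f) (x : Site 2) (du : MDir) (hd : du.1 = 1) (z : Site 2)
    (yT : Site 2) {τ : ℤ} (hτ : τ = 1 ∨ τ = -1) {q k : ℕ}
    (hT0 : |FcA κ Φ t p D g f yT + τ * u₀A κ Φ t p D g f * (k : ℤ) - T0Y κ Φ t p D g f x z| ≤ 3 * u₀A κ Φ t p D g f)
    (hq3 : (q : ℤ) + (k : ℤ) * (RA' κ Φ t p D mk : ℤ) ≤ 3 * ((nL κ Φ t p D g f) : ℤ)) (hℓk : 11 * ((k : ℤ) * (RA' κ Φ t p D mk : ℤ) + 4) ≤ ((ℓL κ Φ t p D g f) : ℤ)) (hs0 : 6 * (RA' κ Φ t p D mk : ℤ) + 11 ≤ u₀A κ Φ t p D g f) :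
    ((nL κ Φ t p D g f) : ℤ) * (modulus (nL κ Φ t p D g f) (hL κ Φ t p D g f) (vL κ Φ t p D g f) (vβL κ Φ t p D g f)) * (FcA κ Φ t p D g f yT + 1) + ((((fcellsA κ Φ t p D g f).s 0 : ℕ) : ℤ)) * (modulus (nL κ Φ t p D g f) (hL κ Φ t p D g f) (vL κ Φ t p D g f) (vβL κ Φ t p D g f)) * xCSHi (nL κ Φ t p D g f) q (RA' κ Φ t p D mk) τ k +
        ((((fcellsA κ Φ t p D g f).s 0 : ℕ) : ℤ)) * (((nL κ Φ t p D g f) : ℕ) : ℤ) * (shearUnit (nL κ Φ t p D g f) (hL κ Φ t p D g f) : ℤ) * (xCoreB (nL κ Φ t p D g f) (ℓL κ Φ t p D g f) (hL κ Φ t p D g f) (RA' κ Φ t p D mk) k + 1) ≤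
      ((nL κ Φ t p D g f) : ℤ) * (modulus (nL κ Φ t p D g f) (hL κ Φ t p D g f) (vL κ Φ t p D g f) (vβL κ Φ t p D g f)) * ((fcellsA κ Φ t p D g f).cen (x + stepVec du) 0 + (b0TA κ Φ t p D g f 0 : ℤ) - 2 - z 0) := by
  obtain ⟨hn1, hℓ1⟩ := one_le_of_eqNumL κ Φ t p D g f hN
  have hm0 : 0 < (modulus (nL κ Φ t p D g f) (hL κ Φ t p D g f) (vL κ Φ t p D g f) (vβL κ Φ t p D g f)) := Skelφ.NegPrm.modulus_vβOf_pos hn1 hℓ1 _ _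
  obtain ⟨-, hhi⟩ := xCS_eval (nL κ Φ t p D g f) q (RA' κ Φ t p D mk) hτ k
  have hroom := lastCore_room₀ κ Φ t p D mk g f hN hκ hq3 hℓk hs0
  have es : ((((fcellsA κ Φ t p D g f).s 0 : ℕ) : ℤ)) = u₀A κ Φ t p D g f := rfl
  have hb : (b0TA κ Φ t p D g f 0 : ℤ) = 10 * (Neg.Kq κ : ℤ) * u₀A κ Φ t p D g f := (units_eqA κ Φ t p D g f).2.2.2.2.1
  have hT : (fcellsA κ Φ t p D g f).cen (x + stepVec du) 0 - z 0 = T0Y κ Φ t p D g f x z := by rw [cen_step_zero κ Φ t p D g f x du hd]; rfl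
  obtain ⟨a1, a2⟩ := abs_le.1 hT0
  have hn : (1 : ℤ) ≤ ((nL κ Φ t p D g f) : ℤ) := by exact_mod_cast hn1
  rw [es, hb, hhi]
  set m : ℤ := (modulus (nL κ Φ t p D g f) (hL κ Φ t p D g f) (vL κ Φ t p D g f) (vβL κ Φ t p D g f))
  set u : ℤ := u₀A κ Φ t p D g f
  set n : ℤ := ((nL κ Φ t p D g f) : ℤ)
  set Uz : ℤ := (shearUnit (nL κ Φ t p D g f) (hL κ Φ t p D g f) : ℤ)
  set X : ℤ := xCoreB (nL κ Φ t p D g f) (ℓL κ Φ t p D g f) (hL κ Φ t p D g f) (RA' κ Φ t p D mk) k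
  set F0 := FcA κ Φ t p D g f yT
  set T0 := T0Y κ Φ t p D g f x z
  set kR : ℤ := (k : ℤ) * (RA' κ Φ t p D mk : ℤ)
  have hu1 : 1 ≤ u := by linarith [(Nat.cast_nonneg (RA' κ Φ t p D mk) : (0:ℤ) ≤ (RA' κ Φ t p D mk : ℤ))]
  have hL : n * m * (F0 + 1) + n * m * (τ * u * (k : ℤ)) ≤ n * m * ((fcellsA κ Φ t p D g f).cen (x + stepVec du) 0 + 10 * (Neg.Kq κ : ℤ) * u - 2 - z 0) -
      n * m * (10 * (Neg.Kq κ : ℤ) * u - 3 * u - 3) := by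
    have h : F0 + 1 + τ * u * (k : ℤ) + (10 * (Neg.Kq κ : ℤ) * u - 3 * u - 3) ≤ ((fcellsA κ Φ t p D g f).cen (x + stepVec du) 0 - z 0) + 10 * (Neg.Kq κ : ℤ) * u - 2 := by
      rw [hT]; linarith
    have := mul_le_mul_of_nonneg_left h (mul_nonneg (by linarith : (0:ℤ) ≤ n) hm0.le)
    nlinarith
  have e1 : u * m * (τ * ((k : ℤ) * n) + ((q : ℤ) + kR)) = n * m * (τ * u * (k : ℤ)) + u * m * ((q : ℤ) + kR) := by ring
  rw [e1]
  have e2 : u * n * Uz * (X + 1) = u * n * (Uz * (X + 1)) := by ring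
  rw [e2]
  nlinarith

end LastCoreY

end KS

end NegB

end PlanarSkeletonNeg

end Summit.CriticalPhenomena.PercolationContinuityZ3.Theorems.Transplant

end
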